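import Summits.NavierStokesRegularity.FluidComputer.PalasekTowerGermHostApproximantFreeRun
import Summits.NavierStokesRegularity.NavierStokesRegularity.Theorems.PalasekTowerBreakdownEpisodeBaseSuperposedFreeRun

/-!
# `EpisodeBase` (crux stmt-NavierStokesRegularity-19179) from ONE free run of a SCHWARTZ mechanism datum with
# compactly supported approximants and ONE tame free run of a strict-slot carrier — BY NAME

Cell `ns-blowup`, seat `ns-blowup-ecbridge-3` (g7; D-0074 GROUP C «BRIDGE SUPPORT», lineage `host_preparation`).
Route `PalasekTowerBreakdown`, crux `EpisodeBase`, line `slot` v5. Composition of the APPROXIMABLE-AMPLIFIER DOOR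
(`Germ.exists_compact_approximant_freeRun`, FluidComputer, this seat: a Schwartz mechanism datum — e.g. tilted
Gaussian-cored vortex rings, the data of the `𝔄`-hunt OPT-𝔄-1 — whose free run meets the letter is replaced IN
THE KERNEL by a compactly supported approximant whose free run meets the letter with half the margin) with the
dynamic companion rule (`palasekTowerBreakdown_episodeBase_of_superposed_freeRuns`, this seat). LABEL: E–C typing
(KERNEL: theorems only; `--supports` stmt-NavierStokesRegularity-19179). WHAT THIS IS NOT: not Navier–Stokes
evidence — no free run meeting the letter is exhibited; nothing about `RungG 1` or blow-up is asserted.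

* `palasekTowerBreakdown_episodeBase_of_approximable_amplifier_freeRun` — strict-slot carrier `U₁` with ONE free
  run below `(5/3)Y₁ − η`; Schwartz `W` with ONE free run below `(5/3)Y₁ − η` meeting the three level-`1` faces
  `+ η` at `Host.τfirst` inside `‖x‖ ≤ R`; compactly supported smooth divergence-free approximants of `W` of
  speed `< Y₀` at every sup distance `δ > 0` ⟹ `EpisodeBase`.
* `palasekTowerBreakdown_episodeBase_of_approximable_amplifier_tinyCarrier` — the carrier fixed to
  `strictTinyProfile a`, `0 < a ≤ 11/648`.

References: S. Palasek, arXiv:2605.13827 §4 [cite: Palasek2026ElementaryModel, §4]; T. Tao, Anal. PDE 6 (2013),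
Thm. 5.4 [cite: Tao2011, Thm. 5.4 (ii)+(iv)].
-/

noncomputable section

-- `Summit.<Summit>.<Problem>` is the tree's mandated summit-side namespace (CONVENTIONS §2); for this
-- single-conjunct summit the two coincide, so the duplicate is deliberate.
set_option linter.dupNamespace false

namespace Summit.NavierStokesRegularity.NavierStokesRegularity.Theorems

open Set Function MeasureTheory Metric
open scoped ENNReal ContDiff
open Summit.NavierStokesRegularity.NavierStokesRegularity.Theses
open Summit.NavierStokesRegularity.FluidComputer.PalasekTowerClayBridge
open Summit.NavierStokesRegularity.FluidComputer.PalasekTowerClayBridge.Germ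
open Literature.Analysis.FluidPDE

/-- **`EpisodeBase` FROM A SCHWARTZ MECHANISM RUN WITH COMPACT APPROXIMANTS AND A TAME CARRIER RUN.** Let
`h₁ : Germ.LevelZeroData U₁ ρ₁` be a strict-slot carrier with ONE classical finite-energy free run on
`[1, Host.τfirst]` below `(5/3) Y₁ − η`; let `W` be a Schwartz datum (`HasRapidSpatialDecay W`) with ONE
classical finite-energy free run on `[1, Host.τfirst]` below `(5/3) Y₁ − η` showing at `Host.τfirst`, inside
`‖x‖ ≤ R` (`R ≥ 0`), the three level-`1` faces with margin `η > 0`; and let `W` admit, at every sup distance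
`δ > 0`, a smooth divergence-free approximant `W'` with `tsupport W' ⊆ B̄(0, R')`, `R ≤ R'`, speed `< Y₀`.
Then `EpisodeBase`. [cite: Palasek2026ElementaryModel, §4] [cite: Tao2011, Thm. 5.4 (ii)+(iv)] -/
theorem palasekTowerBreakdown_episodeBase_of_approximable_amplifier_freeRun
    {U₁ W : EuclideanSpace ℝ (Fin 3) → EuclideanSpace ℝ (Fin 3)} {ρ₁ R : ℝ} (h₁ : LevelZeroData U₁ ρ₁)
    (hW0 : HasRapidSpatialDecay W) (hR : 0 ≤ R)
    {v₁ : ℝ → EuclideanSpace ℝ (Fin 3) → EuclideanSpace ℝ (Fin 3)} {q₁ : ℝ → EuclideanSpace ℝ (Fin 3) → ℝ}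
    (hv₁ : IsClassicalNSSolutionOn (Icc 1 Host.τfirst) 1 0 v₁ q₁) (hv₁1 : v₁ 1 = U₁)
    (hv₁E : ∃ C : ℝ≥0∞, C < ⊤ ∧ ∀ t ∈ Icc (1 : ℝ) Host.τfirst, ∫⁻ x, ‖v₁ t x‖ₑ ^ 2 ≤ C)
    {v₂ : ℝ → EuclideanSpace ℝ (Fin 3) → EuclideanSpace ℝ (Fin 3)} {q₂ : ℝ → EuclideanSpace ℝ (Fin 3) → ℝ}
    (hv₂ : IsClassicalNSSolutionOn (Icc 1 Host.τfirst) 1 0 v₂ q₂) (hv₂1 : v₂ 1 = W)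
    (hv₂E : ∃ C : ℝ≥0∞, C < ⊤ ∧ ∀ t ∈ Icc (1 : ℝ) Host.τfirst, ∫⁻ x, ‖v₂ t x‖ₑ ^ 2 ≤ C)
    {η : ℝ} (hη : 0 < η)
    (hcap₁ : ∀ t ∈ Icc (1 : ℝ) Host.τfirst, ∀ x, ‖v₁ t x‖ ≤ 5 / 3 * TowerRates.wide.Y 1 - η)
    (hcap₂ : ∀ t ∈ Icc (1 : ℝ) Host.τfirst, ∀ x, ‖v₂ t x‖ ≤ 5 / 3 * TowerRates.wide.Y 1 - η)
    (hspeed : ∃ x, ‖x‖ ≤ R ∧ TowerRates.wide.Y 1 + η ≤ ‖v₂ Host.τfirst x‖)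
    (hstrain : ∃ x, ‖x‖ ≤ R ∧ TowerRates.wide.A 1 + η ≤ ‖fderiv ℝ (v₂ Host.τfirst) x‖)
    (hcore : ∃ (x : EuclideanSpace ℝ (Fin 3)) (γ : ℝ → EuclideanSpace ℝ (Fin 3)),
      ‖x‖ ≤ R ∧ ContDiff ℝ 1 γ ∧ γ 0 = γ 1 ∧
      (∀ s ∈ Icc (0 : ℝ) 1, γ s ∈ closedBall x (1 / TowerRates.wide.N 1)) ∧
      (∀ s ∈ Icc (0 : ℝ) 1, ‖deriv γ s‖ ≤ 8 * Real.pi / TowerRates.wide.N 1) ∧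
      TowerRates.wide.N 1 ^ (TowerRates.wide.β - 2) + η ≤ circulation (v₂ Host.τfirst) γ)
    (happrox : ∀ δ : ℝ, 0 < δ → ∃ (W' : EuclideanSpace ℝ (Fin 3) → EuclideanSpace ℝ (Fin 3)) (R' : ℝ),
      ContDiff ℝ ∞ W' ∧ VectorCalculus.IsDivFree W' ∧ tsupport W' ⊆ closedBall 0 R' ∧
      (∀ x, ‖W' x‖ < TowerRates.wide.Y 0) ∧ R ≤ R' ∧ ∀ x, ‖W' x - W x‖ ≤ δ) :
    PalasekTowerBreakdown.EpisodeBase := by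
  obtain ⟨W', R', u, p, hW', hdivW', hW'supp, hW'lt, hR', hu, hu1, huE, hcap, hsp, hst, hco⟩ :=
    exists_compact_approximant_freeRun hW0 hR hv₂ hv₂1 hv₂E hη hcap₂ hspeed hstrain hcore happrox
  have hcap₁' : ∀ t ∈ Icc (1 : ℝ) Host.τfirst, ∀ x, ‖v₁ t x‖ ≤ 5 / 3 * TowerRates.wide.Y 1 - η / 2 :=
    fun t ht x => (hcap₁ t ht x).trans (by linarith)
  exact palasekTowerBreakdown_episodeBase_of_superposed_freeRuns h₁ hW' hdivW' hW'supp hW'lt hR' hv₁ hv₁1 hv₁E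
    hu hu1 huE (half_pos hη) hcap₁' hcap hsp hst hco

/-- **The same with the numeric tiny carrier** `strictTinyProfile a`, `0 < a ≤ 11/648`
(`Germ.levelZeroData_strictTinyProfile_of_le`). [cite: Palasek2026ElementaryModel, §4] -/
theorem palasekTowerBreakdown_episodeBase_of_approximable_amplifier_tinyCarrier {a : ℝ} (ha : 0 < a)
    (ha' : a ≤ 11 / 648)
    {W : EuclideanSpace ℝ (Fin 3) → EuclideanSpace ℝ (Fin 3)} {R : ℝ} (hW0 : HasRapidSpatialDecay W) (hR : 0 ≤ R)
    {v₁ : ℝ → EuclideanSpace ℝ (Fin 3) → EuclideanSpace ℝ (Fin 3)} {q₁ : ℝ → EuclideanSpace ℝ (Fin 3) → ℝ}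
    (hv₁ : IsClassicalNSSolutionOn (Icc 1 Host.τfirst) 1 0 v₁ q₁) (hv₁1 : v₁ 1 = strictTinyProfile a)
    (hv₁E : ∃ C : ℝ≥0∞, C < ⊤ ∧ ∀ t ∈ Icc (1 : ℝ) Host.τfirst, ∫⁻ x, ‖v₁ t x‖ₑ ^ 2 ≤ C)
    {v₂ : ℝ → EuclideanSpace ℝ (Fin 3) → EuclideanSpace ℝ (Fin 3)} {q₂ : ℝ → EuclideanSpace ℝ (Fin 3) → ℝ}
    (hv₂ : IsClassicalNSSolutionOn (Icc 1 Host.τfirst) 1 0 v₂ q₂) (hv₂1 : v₂ 1 = W)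
    (hv₂E : ∃ C : ℝ≥0∞, C < ⊤ ∧ ∀ t ∈ Icc (1 : ℝ) Host.τfirst, ∫⁻ x, ‖v₂ t x‖ₑ ^ 2 ≤ C)
    {η : ℝ} (hη : 0 < η)
    (hcap₁ : ∀ t ∈ Icc (1 : ℝ) Host.τfirst, ∀ x, ‖v₁ t x‖ ≤ 5 / 3 * TowerRates.wide.Y 1 - η)
    (hcap₂ : ∀ t ∈ Icc (1 : ℝ) Host.τfirst, ∀ x, ‖v₂ t x‖ ≤ 5 / 3 * TowerRates.wide.Y 1 - η)
    (hspeed : ∃ x, ‖x‖ ≤ R ∧ TowerRates.wide.Y 1 + η ≤ ‖v₂ Host.τfirst x‖)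
    (hstrain : ∃ x, ‖x‖ ≤ R ∧ TowerRates.wide.A 1 + η ≤ ‖fderiv ℝ (v₂ Host.τfirst) x‖)
    (hcore : ∃ (x : EuclideanSpace ℝ (Fin 3)) (γ : ℝ → EuclideanSpace ℝ (Fin 3)),
      ‖x‖ ≤ R ∧ ContDiff ℝ 1 γ ∧ γ 0 = γ 1 ∧
      (∀ s ∈ Icc (0 : ℝ) 1, γ s ∈ closedBall x (1 / TowerRates.wide.N 1)) ∧
      (∀ s ∈ Icc (0 : ℝ) 1, ‖deriv γ s‖ ≤ 8 * Real.pi / TowerRates.wide.N 1) ∧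
      TowerRates.wide.N 1 ^ (TowerRates.wide.β - 2) + η ≤ circulation (v₂ Host.τfirst) γ)
    (happrox : ∀ δ : ℝ, 0 < δ → ∃ (W' : EuclideanSpace ℝ (Fin 3) → EuclideanSpace ℝ (Fin 3)) (R' : ℝ),
      ContDiff ℝ ∞ W' ∧ VectorCalculus.IsDivFree W' ∧ tsupport W' ⊆ closedBall 0 R' ∧
      (∀ x, ‖W' x‖ < TowerRates.wide.Y 0) ∧ R ≤ R' ∧ ∀ x, ‖W' x - W x‖ ≤ δ) :
    PalasekTowerBreakdown.EpisodeBase :=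
  palasekTowerBreakdown_episodeBase_of_approximable_amplifier_freeRun (levelZeroData_strictTinyProfile_of_le ha ha')
    hW0 hR hv₁ hv₁1 hv₁E hv₂ hv₂1 hv₂E hη hcap₁ hcap₂ hspeed hstrain hcore happrox

end Summit.NavierStokesRegularity.NavierStokesRegularity.Theorems

end
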